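import Literature.Computability.Complexity.HardCoreMinMax
import Literature.Probability.Distributions.IndepProductLaw
import Mathlib.Probability.ProbabilityMassFunction.Constructions
import HarnessLib

/-!
# Hoeffding's inequality for independent discrete samples (`PMF` form)

Topic `Probability/Moments`; companion of `HoeffdingCounting.lean` (Hoeffding's lemma and inequality in
the measure-free COUNTING form on a finite product `∏ᵢ κᵢ`, i.e. for the uniform law). This file gives
the WEIGHTED form — an arbitrary product of finitely supported distributions `wᵢ` on finite types — and
packages it for the tree's product law `indepLaw K p : PMF (Fin K → α)` of independent discrete variables
(`Probability/Distributions/IndepProductLaw.lean`; the iid product `LWE.iidPMF` is its constant case,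
`indepLaw_const` in `Computability/Cryptography/IndepLawBridge.lean`):

* (used, not restated) the weighted Hoeffding lemma and inequality of the tree,
  `HardCoreMinMax.hoeffding_lemma_weighted` / `HardCoreMinMax.hoeffding_weighted_pi`
  (`Computability/Complexity/HardCoreMinMax.lean`, Hoeffding 1963, Thm. 2 and (4.16)): under a product
  weight `W(y) = ∏ᵢ wᵢ(yᵢ)` of distributions `wᵢ` on finite types, the `W`-mass of `{y : ∑ᵢ fᵢ(yᵢ) ≥ t}`
  is `≤ exp(-t²/(2 ∑ᵢ cᵢ²))` for `wᵢ`-mean-zero `fᵢ` with `|fᵢ| ≤ cᵢ`;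
* `toReal_toOuterMeasure_indepLaw_sum_ge_le` — the same for the law `indepLaw K p` on a finite type:
  `Pr[∑ⱼ fⱼ(yⱼ) ≥ t] ≤ exp(-t²/(2∑ⱼ cⱼ²))`;
* `toReal_toOuterMeasure_indepLaw_sum_ge_mul_le`, `toReal_toOuterMeasure_indepLaw_sum_lt_mul_le` — the
  EMPIRICAL-MEAN form for `K` independent samples of laws `p j` and ONE bounded statistic `|g| ≤ B` with
  means `μⱼ = 𝔼_{p j}[g] ∈ [μ⁻, μ⁺]`: `Pr[∑ⱼ g(yⱼ) ≥ Kθ] ≤ exp(-K(θ - μ⁺)²/(8B²))` for `θ ≥ μ⁺` and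
  `Pr[∑ⱼ g(yⱼ) < Kθ] ≤ exp(-K(μ⁻ - θ)²/(8B²))` for `θ ≤ μ⁻` — the Chernoff/Hoeffding step of sampling
  arguments ("estimate a mean to within a constant by `poly(n)` samples, error `2^{-n}`"), e.g. Regev 2009,
  Lemma 3.6 (verifying an `LWE` secret), the consumer this file was written for.

All statements are theorems. (The weighted lemmas are imported from `HardCoreMinMax.lean`, where they
were first proved for Impagliazzo's hard-core lemma; `HoeffdingCounting.lean` already records that a
librarian pass should make `Probability/Moments` their canonical home — this file is the natural target
of that move, after which its import of `HardCoreMinMax` can be dropped.)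

## References

* W. Hoeffding, *Probability inequalities for sums of bounded random variables*, J. Amer. Statist.
  Assoc. 58 (1963) 13–30, Thm. 2 and (4.16) [Hoeffding1963].
* O. Regev, *On lattices, learning with errors, random linear codes, and cryptography*, J. ACM 56
  (2009), art. 34, proof of Lemma 3.6 ("an additive error of at most … by the Chernoff bound") — a consumer.
-/

noncomputable section

open Finset Real
open scoped ENNReal

namespace Literature.Probability.Moments

open Literature.Probability.Distributions Literature.Computability.Complexity

/-! ### The `PMF` form: independent discrete samples on a finite type -/

section IndepLaw

variable {α : Type*} [Fintype α]

/-- The mass of an event under a `PMF` on a finite type, in `ℝ`: `Pr[A] = ∑_{y ∈ A} p(y)`. [folklore] -/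
theorem toReal_toOuterMeasure_eq_sum_filter (p : PMF α) (A : Set α) [DecidablePred (· ∈ A)] :
    (p.toOuterMeasure A).toReal = ∑ y ∈ Finset.univ.filter (· ∈ A), (p y).toReal := by
  classical
  have hA : A = ↑(Finset.univ.filter (· ∈ A) : Finset α) := by
    ext y; simp
  conv_lhs => rw [hA, PMF.toOuterMeasure_apply_finset]
  rw [ENNReal.toReal_sum fun y _ => PMF.apply_ne_top p y]

/-- A `PMF` gives every set mass at most `1`. [folklore] -/
theorem pmf_toOuterMeasure_le_one {β : Type*} (p : PMF β) (A : Set β) : p.toOuterMeasure A ≤ 1 :=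
  (p.toOuterMeasure.mono (Set.subset_univ A)).trans_eq
    ((p.toOuterMeasure_apply_eq_one_iff Set.univ).2 (Set.subset_univ _))

/-- The mass a `PMF` gives to a set is finite. [folklore] -/
theorem pmf_toOuterMeasure_ne_top {β : Type*} (p : PMF β) (A : Set β) : p.toOuterMeasure A ≠ ∞ :=
  ne_top_of_le_ne_top ENNReal.one_ne_top (pmf_toOuterMeasure_le_one p A)

/-- The real mass a `PMF` gives to a set is at most `1`. [folklore] -/
theorem pmf_toReal_toOuterMeasure_le_one {β : Type*} (p : PMF β) (A : Set β) : (p.toOuterMeasure A).toReal ≤ 1 :=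
  ENNReal.toReal_le_of_le_ofReal zero_le_one (by rw [ENNReal.ofReal_one]; exact pmf_toOuterMeasure_le_one p A)

omit [Fintype α] in
/-- The masses of `indepLaw K p` in `ℝ` are the product weights `∏ⱼ (p j (y j)).toReal`. [folklore] -/
theorem toReal_indepLaw_apply {K : ℕ} (p : Fin K → PMF α) (y : Fin K → α) :
    (indepLaw K p y).toReal = ∏ j, (p j (y j)).toReal := by
  rw [indepLaw_apply, ENNReal.toReal_prod]

/-- A `PMF` on a finite type has total real mass `1`. [folklore] -/
theorem sum_toReal_eq_one (p : PMF α) : ∑ a, (p a).toReal = 1 := by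
  have h := p.tsum_coe
  rw [tsum_fintype] at h
  rw [← ENNReal.toReal_sum fun a _ => PMF.apply_ne_top p a, h, ENNReal.toReal_one]

/-- **Hoeffding's inequality for independent discrete samples** (one-sided, mean-zero form): for the
product law `indepLaw K p` of independent `yⱼ ∼ p j` on a finite type and `p j`-mean-zero statistics
`fⱼ` with `|fⱼ| ≤ cⱼ`, `Pr[∑ⱼ fⱼ(yⱼ) ≥ t] ≤ exp(-t²/(2 ∑ⱼ cⱼ²))` (`t ≥ 0`, `∑ⱼ cⱼ² > 0`).
[cite: Hoeffding1963, Thm. 2] -/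
theorem toReal_toOuterMeasure_indepLaw_sum_ge_le {K : ℕ} (p : Fin K → PMF α) (f : Fin K → α → ℝ)
    (c : Fin K → ℝ) (hf0 : ∀ j, ∑ a, (p j a).toReal * f j a = 0) (hfc : ∀ j a, |f j a| ≤ c j)
    {t : ℝ} (ht : 0 ≤ t) (hS : 0 < ∑ j, c j ^ 2) :
    ((indepLaw K p).toOuterMeasure {y | t ≤ ∑ j, f j (y j)}).toReal ≤
      Real.exp (-(t ^ 2 / (2 * ∑ j, c j ^ 2))) := by
  classical
  rw [toReal_toOuterMeasure_eq_sum_filter]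
  simp_rw [toReal_indepLaw_apply]
  have h := HardCoreMinMax.hoeffding_weighted_pi (fun j a => (p j a).toReal) f c
    (fun j a => ENNReal.toReal_nonneg)
    (fun j => sum_toReal_eq_one (p j)) hf0 hfc ht hS
  convert h using 2
  ext y
  simp

/-- **Empirical means, upper tail.** `K` independent samples `yⱼ ∼ p j` on a finite type, one bounded
statistic `|g| ≤ B` whose means `μⱼ = ∑ₐ p j(a) g(a)` are all `≤ μ⁺`, and a threshold `θ ≥ μ⁺`:
`Pr[∑ⱼ g(yⱼ) ≥ K·θ] ≤ exp(-K(θ - μ⁺)²/(8B²))` (Hoeffding with `fⱼ = g - μⱼ`, `cⱼ = 2B`, `t = K(θ - μ⁺)`).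
[cite: Hoeffding1963, Thm. 2] -/
theorem toReal_toOuterMeasure_indepLaw_sum_ge_mul_le {K : ℕ} (p : Fin K → PMF α) (g : α → ℝ) {B μ θ : ℝ}
    (hB : 0 < B) (hg : ∀ a, |g a| ≤ B) (hμ : ∀ j, ∑ a, (p j a).toReal * g a ≤ μ) (hθ : μ ≤ θ) :
    ((indepLaw K p).toOuterMeasure {y | (K : ℝ) * θ ≤ ∑ j, g (y j)}).toReal ≤
      Real.exp (-((K : ℝ) * (θ - μ) ^ 2 / (8 * B ^ 2))) := by
  classical
  rcases Nat.eq_zero_or_pos K with rfl | hK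
  · simp only [Nat.cast_zero, zero_mul, zero_div, neg_zero, Real.exp_zero]
    exact pmf_toReal_toOuterMeasure_le_one _ _
  -- centre: `f j = g - μ j`
  set m : Fin K → ℝ := fun j => ∑ a, (p j a).toReal * g a with hm
  have hmB : ∀ j, |m j| ≤ B := fun j => by
    have h1 : |m j| ≤ ∑ a, (p j a).toReal * B := by
      refine (abs_sum_le_sum_abs _ _).trans (sum_le_sum fun a _ => ?_)
      rw [abs_mul, abs_of_nonneg ENNReal.toReal_nonneg]
      exact mul_le_mul_of_nonneg_left (hg a) ENNReal.toReal_nonneg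
    rwa [← sum_mul, sum_toReal_eq_one, one_mul] at h1
  have hf0 : ∀ j, ∑ a, (p j a).toReal * (g a - m j) = 0 := fun j => by
    simp_rw [mul_sub, sum_sub_distrib, ← sum_mul, sum_toReal_eq_one, one_mul]
    exact sub_self _
  have hfc : ∀ j a, |g a - m j| ≤ 2 * B := fun j a => by
    calc |g a - m j| ≤ |g a| + |m j| := abs_sub _ _
      _ ≤ B + B := add_le_add (hg a) (hmB j)
      _ = 2 * B := by ring
  have hS : 0 < ∑ _j : Fin K, (2 * B) ^ 2 := by
    rw [sum_const, card_univ, Fintype.card_fin, nsmul_eq_mul]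
    have : (0 : ℝ) < K := Nat.cast_pos.2 hK
    positivity
  have ht : 0 ≤ (K : ℝ) * (θ - μ) := mul_nonneg (Nat.cast_nonneg _) (sub_nonneg.2 hθ)
  have hmain := toReal_toOuterMeasure_indepLaw_sum_ge_le p (fun j a => g a - m j) (fun _ => 2 * B)
    hf0 hfc ht hS
  -- the event `{Kθ ≤ ∑ g}` is contained in `{K(θ - μ) ≤ ∑ (g - m j)}`
  have hsub : {y : Fin K → α | (K : ℝ) * θ ≤ ∑ j, g (y j)} ⊆
      {y | (K : ℝ) * (θ - μ) ≤ ∑ j, (g (y j) - m j)} := by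
    intro y hy
    simp only [Set.mem_setOf_eq] at hy ⊢
    rw [sum_sub_distrib]
    have hms : ∑ j, m j ≤ (K : ℝ) * μ := by
      calc ∑ j, m j ≤ ∑ _j : Fin K, μ := sum_le_sum fun j _ => hμ j
        _ = (K : ℝ) * μ := by rw [sum_const, card_univ, Fintype.card_fin, nsmul_eq_mul]
    linarith
  have hmono := ENNReal.toReal_mono (pmf_toOuterMeasure_ne_top _ _)
    ((indepLaw K p).toOuterMeasure.mono hsub)
  refine hmono.trans (hmain.trans (le_of_eq ?_))
  congr 1
  rw [sum_const, card_univ, Fintype.card_fin, nsmul_eq_mul]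
  have hK' : (K : ℝ) ≠ 0 := Nat.cast_ne_zero.2 hK.ne'
  field_simp
  ring

/-- **Empirical means, lower tail.** `K` independent samples `yⱼ ∼ p j` on a finite type, one bounded
statistic `|g| ≤ B` whose means `μⱼ = ∑ₐ p j(a) g(a)` are all `≥ μ⁻`, and a threshold `θ ≤ μ⁻`:
`Pr[∑ⱼ g(yⱼ) < K·θ] ≤ exp(-K(μ⁻ - θ)²/(8B²))` (the upper tail for `-g`). [cite: Hoeffding1963, Thm. 2] -/
theorem toReal_toOuterMeasure_indepLaw_sum_lt_mul_le {K : ℕ} (p : Fin K → PMF α) (g : α → ℝ) {B μ θ : ℝ}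
    (hB : 0 < B) (hg : ∀ a, |g a| ≤ B) (hμ : ∀ j, μ ≤ ∑ a, (p j a).toReal * g a) (hθ : θ ≤ μ) :
    ((indepLaw K p).toOuterMeasure {y | ∑ j, g (y j) < (K : ℝ) * θ}).toReal ≤
      Real.exp (-((K : ℝ) * (μ - θ) ^ 2 / (8 * B ^ 2))) := by
  have hg' : ∀ a, |(-g a)| ≤ B := fun a => by rw [abs_neg]; exact hg a
  have hμ' : ∀ j, ∑ a, (p j a).toReal * (-g a) ≤ -μ := fun j => by
    simp_rw [mul_neg, sum_neg_distrib]
    exact neg_le_neg (hμ j)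
  have h := toReal_toOuterMeasure_indepLaw_sum_ge_mul_le p (fun a => -g a) hB hg' hμ' (neg_le_neg hθ)
  have hsub : {y : Fin K → α | ∑ j, g (y j) < (K : ℝ) * θ} ⊆
      {y | (K : ℝ) * (-θ) ≤ ∑ j, -g (y j)} := by
    intro y hy
    simp only [Set.mem_setOf_eq, sum_neg_distrib, mul_neg] at hy ⊢
    linarith
  have hmono := ENNReal.toReal_mono (pmf_toOuterMeasure_ne_top _ _)
    ((indepLaw K p).toOuterMeasure.mono hsub)
  refine hmono.trans (h.trans (le_of_eq ?_))
  congr 1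
  ring

end IndepLaw

end Literature.Probability.Moments

end
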